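import Literature.NumberTheory.GaloisRepresentations.WeilDeligneRepFrobSemisimpleProofs
import Literature.NumberTheory.Automorphic.LParameter
import Literature.NumberTheory.GaloisRepresentations.WeilDeligneOfGalois
import HarnessLib

/-!
# Weil–Deligne bookkeeping (WD-C): the Frobenius-semisimple class is an isomorphism invariant

Discharges hypothesis (WD-C) of `SoloBlind.recGL_eq_of_globalLanglands`
(`SoloBlindLocalAgreement`): if two Weil–Deligne representations `r ≅ r'` (possibly on different
spaces) have Frobenius-semisimplifications then these are isomorphic; in particular on
`Fin n → ℂ` the classes recorded by `HasFrobSemisimpleClass` coincide.  Proof: transport a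
Frobenius-semisimplification of `r` along the isomorphism (conjugating `ρ` and `N` by the linear
isomorphism; semisimplicity of `ρ^{ss}(w)` is preserved since the minimal polynomial is), observe it
is a Frobenius-semisimplification of `r'`, and use uniqueness (tree:
`WeilDeligneRep.existsUnique_frobSemisimplification_holds`, Deligne 1973 §8.5–8.6).

## References

* P. Deligne, *Les constantes des équations fonctionnelles des fonctions L*, Antwerp II, LNM 349
  (1973), §8.4.1, §8.5–8.6. [DeligneAntwerpII1973]
* J. Tate, *Number theoretic background*, Corvallis 1979, (4.1.2)–(4.1.3). [TateCorvallis1979]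
-/

open Module Polynomial

noncomputable section

namespace Summit.Langlands.Langlands.Theorems

namespace SoloBlind

open Literature.NumberTheory.GaloisRepresentations Literature.NumberTheory.Automorphic

variable {F : Type*} [Field F] [ValuativeRel F] [TopologicalSpace F] [IsNonarchimedeanLocalField F]
variable {C : Type*} [Field C] [CharZero C]
variable {V : Type*} [AddCommGroup V] [Module C V] {V' : Type*} [AddCommGroup V'] [Module C V']

/-- **Transport of structure**: a Weil–Deligne representation on `V` and a linear isomorphism
`e : V ≃ V'` give a Weil–Deligne representation on `V'` with `ρ' = e ρ e⁻¹`, `N' = e N e⁻¹`.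
[cite: DeligneAntwerpII1973, §8.4.1] -/
theorem wd_exists_transport (r : WeilDeligneRep F C V) (e : V ≃ₗ[C] V') :
    ∃ r' : WeilDeligneRep F C V',
      (∀ w, r'.ρ w = e.conjAlgEquiv C (r.ρ w)) ∧ r'.N = e.conjAlgEquiv C r.N := by
  obtain ⟨U, hU, hopen, h1⟩ := r.isContinuous
  refine ⟨{ ρ := ((e.conjAlgEquiv C : Module.End C V ≃ₐ[C] Module.End C V') : Module.End C V →* Module.End C V').comp r.ρ
            isContinuous := ⟨U, hU, hopen, fun u hu ↦ by simp [h1 u hu]⟩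
            N := e.conjAlgEquiv C r.N
            isNilpotent_N := r.isNilpotent_N.map _
            conj_N := fun w ↦ ?_ }, fun w ↦ rfl, rfl⟩
  have h := congrArg (e.conjAlgEquiv C) (r.conj_N w)
  rw [← Module.End.mul_eq_comp, ← Module.End.mul_eq_comp, map_mul, map_smul, map_mul] at h
  simpa [Module.End.mul_eq_comp] using h

/-- A Weil–Deligne representation is isomorphic to its transport along a linear isomorphism.
[cite: DeligneAntwerpII1973, §8.4.1] -/
theorem wd_isEquivalent_of_transport {r : WeilDeligneRep F C V} {r' : WeilDeligneRep F C V'}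
    (e : V ≃ₗ[C] V') (hρ : ∀ w, r'.ρ w = e.conjAlgEquiv C (r.ρ w))
    (hN : r'.N = e.conjAlgEquiv C r.N) : r.IsEquivalent r' := by
  have hρ' : ∀ w, (e : V →ₗ[C] V') ∘ₗ r.ρ w = r'.ρ w ∘ₗ (e : V →ₗ[C] V') := fun w ↦ by
    rw [hρ w, LinearEquiv.conjAlgEquiv_apply]
    ext x
    simp
  refine ⟨{ toRepEquiv := Representation.Equiv.mk e hρ', comm_N := ?_ }⟩
  change (e : V →ₗ[C] V') ∘ₗ r.N = r'.N ∘ₗ (e : V →ₗ[C] V')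
  rw [hN, LinearEquiv.conjAlgEquiv_apply]
  ext x
  simp

omit [CharZero C] in
/-- Semisimplicity of an endomorphism is invariant under an algebra isomorphism of endomorphism
rings (the minimal polynomial is). [folklore] -/
theorem isSemisimple_map_algEquiv [FiniteDimensional C V] {f : Module.End C V}
    (φ : Module.End C V ≃ₐ[C] Module.End C V') (hf : f.IsSemisimple) : (φ f).IsSemisimple := by
  refine Module.End.isSemisimple_of_squarefree_aeval_eq_zero hf.minpoly_squarefree ?_
  rw [← minpoly.algEquiv_eq φ f]
  exact minpoly.aeval C _

/-- **Transport of a Frobenius-semisimplification along an isomorphism `r ≅ r'` is a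
Frobenius-semisimplification of `r'`.** [cite: DeligneAntwerpII1973, §8.5–8.6] -/
theorem wd_isFrobSemisimplificationOf_transport [FiniteDimensional C V]
    {r r₁ : WeilDeligneRep F C V} {r' r₁' : WeilDeligneRep F C V'} (e : WeilDeligneRep.Equiv r r')
    (h₁ : r₁.IsFrobSemisimplificationOf r)
    (hρ : ∀ w, r₁'.ρ w = e.toLinearEquiv.conjAlgEquiv C (r₁.ρ w))
    (hN : r₁'.N = e.toLinearEquiv.conjAlgEquiv C r₁.N) :
    r₁'.IsFrobSemisimplificationOf r' := by
  set φ := e.toLinearEquiv.conjAlgEquiv C with hφ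
  -- the isomorphism conjugates `r` into `r'`
  have hrρ : ∀ w, r'.ρ w = φ (r.ρ w) := fun w ↦ by
    have hint : (e.toLinearEquiv : V →ₗ[C] V') ∘ₗ r.ρ w = r'.ρ w ∘ₗ (e.toLinearEquiv : V →ₗ[C] V') :=
      e.toRepEquiv.isIntertwining' w
    rw [hφ, LinearEquiv.conjAlgEquiv_apply, ← LinearMap.comp_assoc,
      LinearEquiv.eq_comp_toLinearMap_symm]
    exact hint.symm
  have hrN : r'.N = φ r.N := by
    have hc : (e.toLinearEquiv : V →ₗ[C] V') ∘ₗ r.N = r'.N ∘ₗ (e.toLinearEquiv : V →ₗ[C] V') :=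
      e.comm_N
    rw [hφ, LinearEquiv.conjAlgEquiv_apply, ← LinearMap.comp_assoc,
      LinearEquiv.eq_comp_toLinearMap_symm]
    exact hc.symm
  refine ⟨by rw [hN, h₁.1, hrN], fun u hu ↦ by rw [hρ, h₁.2.1 u hu, hrρ], fun w ↦ ⟨?_, ?_⟩⟩
  · rw [hρ]
    exact isSemisimple_map_algEquiv φ (h₁.2.2 w).1
  · obtain ⟨m, hm, hcomm, hdec⟩ := (h₁.2.2 w).2
    refine ⟨φ m, hm.map φ, ?_, ?_⟩
    · rw [hρ]
      exact hcomm.map φ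
    · rw [hrρ, hdec, map_add, hρ]

/-- **(WD-C) The Frobenius-semisimple class is an isomorphism invariant**: isomorphic
Weil–Deligne representations on `ℂⁿ` have the same class of Frobenius-semisimplification.
[cite: DeligneAntwerpII1973, §8.5–8.6] [cite: TateCorvallis1979, (4.1.3)] -/
theorem hasFrobSemisimpleClass_unique_of_isEquivalent {n : ℕ}
    {r r' : WeilDeligneRep F ℂ (Fin n → ℂ)} {c c' : Quotient (frobSemisimpleWDSetoid F n)}
    (he : r.IsEquivalent r') (hc : r.HasFrobSemisimpleClass c) (hc' : r'.HasFrobSemisimpleClass c') :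
    c = c' := by
  obtain ⟨e⟩ := he
  obtain ⟨r₁, h₁, rfl⟩ := hc
  obtain ⟨r₂, h₂, rfl⟩ := hc'
  obtain ⟨r₁', hρ, hN⟩ := wd_exists_transport r₁ e.toLinearEquiv
  have h₁' : r₁'.IsFrobSemisimplificationOf r' := wd_isFrobSemisimplificationOf_transport e h₁ hρ hN
  obtain rfl : r₂ = r₁' :=
    (WeilDeligneRep.existsUnique_frobSemisimplification_holds r').unique h₂ h₁'
  exact Quotient.sound (wd_isEquivalent_of_transport e.toLinearEquiv hρ hN)

end SoloBlind

end Summit.Langlands.Langlands.Theorems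

end
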